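import Summits.BirchSwinnertonDyer.BirchSwinnertonDyer.Theorems.UniversalToricDescentCharIdealVacuity
import Literature.NumberTheory.EllipticCurves.IwasawaAlgebraDivisibilityProofs
import Literature.NumberTheory.EllipticCurves.SkinnerUrban2014.CharacteristicIdealBaseChangeProofs
import Literature.NumberTheory.EllipticCurves.Kato2004.MainConjectureSkeletonProofs
import Literature.NumberTheory.EllipticCurves.Kobayashi2003.SignedSelmerModuleFiniteProofs
import Literature.NumberTheory.EllipticCurves.PAdicBSD
import HarnessLib

/-!
# Route `ThetaPartnerAtTwo` (TP2), crux K2r0P `SignedMainConjectureCMTwoRankZeroOfPub` (stmt-BirchSwinnertonDyer-24945),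
# line `rankzero` v14: the (LD±2^k)-SHAPE of the load-bearing stub versus LOWER divisibility in local lengths off `p`
# (any prime, any sign, any dual datum) — part 1 of 2 (algebra); part 2 (`…LowerOffTwoAtTwo`) wires it to the crux at `p = 2`

HONEST FRAMING (cell `pub/bsd-wall`, W-ALL row 1; width seat `bsd-wall-tp2-p2-w2` g2, `--supports` only; the lead `bsd-wall-tp2-p2`
holds the item). THEOREMS ONLY — no definition, no named fact, no instance, no `sorry`; no `Theses` import (route-independent);
nothing about any Selmer group is asserted beyond the displayed binders; this file closes no item and the crux is NOT proved; BSD is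
NOT proved by any of this.

WHY. The registered load-bearing stub `stub_signedLowerDivisibilityUpToTwoPowerNonUnitCMTwo` ((LD±2^k)_A) of skeleton `rankzero` v14
is typed in the «`∃ g h m m'`, `char X⁺ = (g)`, `2^{m'}·ι g = 2^m·ϖ·ι(L♭·h)`» currency of the route decl. Every port that can supply
it (Kato §15 / JLK 2011 over the `K`-tower, or Pollack–Rubin §§6–7, transported to `ℚ_∞`; dossier `Cruxes/…/PR04-AT-TWO.md`, memo
`ER2-PRINT-SOURCE-w2.md` §5 (P1)–(P4)) ends in LOCAL LENGTHS at height-one primes of `Λ = ℤ_p⟦T⟧` AWAY FROM `(p)` — the currency in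
which the sister crux K3's research residue is typed (`SignedKatoOffTwo.signedKatoDivisibilityUpToAtTwo_iff_offTwo`: the UPPER half
`ℓ_𝔭(X⁺) ≤ ℓ_𝔭(Λ/(L♭))`). This file is the mirror image for the LOWER half:

* §1 (commutative algebra, any Noetherian UFD `R`, prime element `π₀`, `L ≠ 0`, `X` finitely generated torsion with `char X = (g)`):
  `(∃ m h, π₀^m·g = L·h) ↔ ∀ height-one 𝔭 ∌ π₀, ℓ_𝔭(R/(L)) ≤ ℓ_𝔭(X)` (`exists_pow_mul_eq_mul_iff_lengthAt_quotient_le`).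
* §2 (any prime `p`, any number field, any sign `ε`, any dual datum `D` of `Sel^ε(E/K_∞)`, `ϖ ∈ ℚˣ`): the (LD±2^k)-SHAPED conclusion
  `∃ g h m m', char X^ε = (g) ∧ C(p^{m'})·ι g = C(p^m·ϖ)·ι(L·h)` is `∃ g, char X^ε = (g) ∧ L ∣ C(p)^k·g` (`lowerUpTo_iff_exists_C_pow_mul_eq`:
  the period ratio and the two `p`-powers are cosmetic); for `L ≠ 0` it IMPLIES `∀ height-one 𝔭 ∌ p, ℓ_𝔭(Λ/(L)) ≤ ℓ_𝔭(X^ε)`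
  unconditionally (`lengthAt_quotient_le_of_lowerUpTo`; off torsion `ℓ_𝔭(X^ε) = ⊤`), and is EQUIVALENT to it when `X^ε` is `Λ`-torsion
  (`lowerUpTo_of_lengthAt_quotient_le`, `lowerUpTo_iff_lengthAt_quotient_le`). Unlike K3's shape the lower shape is NOT vacuous off
  torsion (`char = ⊤` would force `L ∣ p^k`), so torsion is a genuine input of `←` — at analytic rank `0` it is a theorem from print
  (part 2, `SignedLowerOffTwo.signedTorsionTwoRankZero_of_pub`).

In Kobayashi's four-term sequence the length form is «`ℓ_𝔭(X_str) ≥ ℓ_𝔭(𝐇¹/Λz)` + Poitou–Tate exactness + `ord_𝔭 Col⁺(z) ≥ ord_𝔭 L♭`» at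
`𝔭 ∌ p` — the NON-Euler-system half (Rubin / JLK equality for CM forms), research at `p = 2`; nothing of it is asserted here.

References: [Kobayashi2003] Thm. 1.3 (i) (p. 2), Thm. 4.1 (p. 8), Thm. 7.3 (pp. 12–13); [PollackRubin2004] Thm. 7.3 (p > 2);
[Kato2004Asterisque] Lemma 15.13, Prop. 15.17 (pp. 264–265), Thm. 17.4 (2) (p. 273); [Washington1997] §13.2; [SkinnerUrban2014] §3.1.6.
-/

set_option autoImplicit false
-- the Theorems namespace of this sub repeats the summit name by design (D-0017 nested layout)
set_option linter.dupNamespace false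

noncomputable section

open scoped Classical

namespace Summit.BirchSwinnertonDyer.BirchSwinnertonDyer.Theorems

open Literature.NumberTheory.EllipticCurves WeierstrassCurve Literature.NumberTheory.EllipticCurves.ZpExtension
  Literature.NumberTheory.EllipticCurves.Kobayashi2003 Literature.NumberTheory.EllipticCurves.Module

namespace SignedLowerOffTwo

/-! ## §1 Commutative algebra: `L ∣ π₀^m·g` versus local lengths off `π₀` -/

section Algebra

variable {R : Type*} [CommRing R] [IsDomain R] [IsNoetherianRing R] [UniqueFactorizationMonoid R]
  {X : Type*} [AddCommGroup X] [_root_.Module R X]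

omit [IsNoetherianRing R] [UniqueFactorizationMonoid R] in
/-- `R/(a)` is a torsion `R`-module for `a ≠ 0` (killed by `a`). [folklore] -/
private theorem isTorsion_quotient_span_singleton {a : R} (ha : a ≠ 0) :
    Module.IsTorsion R (R ⧸ Ideal.span {a}) := by
  have hby : Module.IsTorsionBy R (R ⧸ Ideal.span {a}) a :=
    (Module.isTorsionBy_quotient_iff _ a).mpr fun y ↦ by
      rw [smul_eq_mul]
      exact Ideal.mul_mem_right y _ (Ideal.mem_span_singleton_self a)
  exact fun x ↦ ⟨⟨a, mem_nonZeroDivisors_of_ne_zero ha⟩, @hby x⟩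

omit [IsNoetherianRing R] [UniqueFactorizationMonoid R] in
/-- Off a prime element `π₀`, `ℓ_𝔭(R/(π₀^m·G)) = ℓ_𝔭(R/(G))` at every prime `𝔭 ∌ π₀` (the tree's
`SignedKatoOffTwo.lengthAt_quotient_span_pow_mul_eq_of_not_mem`, re-proved to keep this file route-independent). [folklore] -/
private theorem lengthAt_quotient_span_pow_mul_eq_of_not_mem {π₀ : R} (hπ₀ : Prime π₀) (m : ℕ) (G : R)
    (𝔭 : PrimeSpectrum R) (h𝔭 : π₀ ∉ 𝔭.asIdeal) :
    lengthAt R (R ⧸ Ideal.span {π₀ ^ m * G}) 𝔭 = lengthAt R (R ⧸ Ideal.span {G}) 𝔭 := by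
  rw [lengthAt_quotient_span_singleton_mul G (pow_ne_zero m hπ₀.ne_zero) 𝔭,
    lengthAt_quotient_eq_zero_of_not_le (I := Ideal.span {π₀ ^ m}) ?_, zero_add]
  rw [Ideal.span_singleton_le_iff_mem]
  exact fun h ↦ h𝔭 (𝔭.isPrime.mem_of_pow_mem m h)

/-- **`L ∣ π₀^m·g` for some `m` ⟺ `ℓ_𝔭(R/(L)) ≤ ℓ_𝔭(X)` at every height-one prime `𝔭 ∌ π₀`**, for `R` a Noetherian UFD,
`π₀` a prime element, `L ≠ 0`, and `X` a finitely generated torsion `R`-module with `char X = (g)`. `←`: `char(R/(g)) = (g) =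
char X` so `ℓ_𝔭(X) = ℓ_𝔭(R/(g))` (`SkinnerUrban2014.lengthAt_eq_of_charIdeal_eq`), and the tree's
`Module.exists_pow_mul_mem_charIdeal_of_lengthAt_le` applied to the torsion module `R/(L)` gives `π₀^m·g ∈ char(R/(L)) = (L)`;
`→`: `(π₀^m g) ⊆ (L)` bounds `ℓ_𝔭(R/(L))` by `ℓ_𝔭(R/(π₀^m g)) = ℓ_𝔭(R/(g)) = ℓ_𝔭(X)` off `π₀`
(`SkinnerUrban2014.lengthAt_le_of_charIdeal_le`). The LOWER-divisibility twin of
`SignedKatoOffTwo.exists_pow_mul_mem_charIdeal_iff_lengthAt_le` (there: `π₀^m·G ∈ char X`, the UPPER half).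
[cite: Washington1997, §13.2] [cite: SkinnerUrban2014, §3.1.6 (p. 20)] -/
theorem exists_pow_mul_eq_mul_iff_lengthAt_quotient_le [Module.Finite R X] (hX : Module.IsTorsion R X)
    {π₀ : R} (hπ₀ : Prime π₀) {L : R} (hL : L ≠ 0) {g : R} (hg : charIdeal R X = Ideal.span {g}) :
    (∃ (m : ℕ) (h : R), π₀ ^ m * g = L * h) ↔
      ∀ 𝔭 : PrimeSpectrum R, 𝔭.asIdeal.height = 1 → π₀ ∉ 𝔭.asIdeal →
        lengthAt R (R ⧸ Ideal.span {L}) 𝔭 ≤ lengthAt R X 𝔭 := by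
  -- `g ≠ 0`: the characteristic ideal of a torsion module is a product of non-zero prime powers
  have hg0 : g ≠ 0 := by
    obtain ⟨t, π, ht, -, -, hchar⟩ := SkinnerUrban2014.exists_charIdeal_eq_span_prod (M := X) hX
    have hprod : (∏ 𝔮 ∈ t, π 𝔮 ^ (lengthAt R X 𝔮).toNat) ≠ 0 :=
      Finset.prod_ne_zero_iff.mpr fun 𝔮 h𝔮 ↦ pow_ne_zero _ (ht 𝔮 h𝔮).2.1.ne_zero
    rintro rfl
    rw [hg, Ideal.span_singleton_eq_span_singleton] at hchar
    exact hprod (associated_zero_iff_eq_zero _ |>.mp hchar.symm)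
  have hQg := isTorsion_quotient_span_singleton (R := R) hg0
  have hQL := isTorsion_quotient_span_singleton (R := R) hL
  have hcharg : charIdeal R (R ⧸ Ideal.span {g}) = charIdeal R X := by
    rw [charIdeal_eq_span_of_lengthAt_eq_quotient hg0 fun _ _ ↦ rfl, hg]
  have hcharL : charIdeal R (R ⧸ Ideal.span {L}) = Ideal.span {L} :=
    charIdeal_eq_span_of_lengthAt_eq_quotient hL fun _ _ ↦ rfl
  -- `ℓ_𝔭(X) = ℓ_𝔭(R/(g))` at height one
  have hleng : ∀ 𝔭 : PrimeSpectrum R, 𝔭.asIdeal.height = 1 →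
      lengthAt R (R ⧸ Ideal.span {g}) 𝔭 = lengthAt R X 𝔭 := fun 𝔭 h𝔭 ↦
    SkinnerUrban2014.lengthAt_eq_of_charIdeal_eq hQg hX hcharg 𝔭 h𝔭
  constructor
  · rintro ⟨m, h, hmh⟩ 𝔭 h𝔭 hπ𝔭
    have hne : π₀ ^ m * g ≠ 0 := mul_ne_zero (pow_ne_zero m hπ₀.ne_zero) hg0
    have hQ := isTorsion_quotient_span_singleton (R := R) hne
    have hcharQ : charIdeal R (R ⧸ Ideal.span {π₀ ^ m * g}) = Ideal.span {π₀ ^ m * g} :=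
      charIdeal_eq_span_of_lengthAt_eq_quotient hne fun _ _ ↦ rfl
    have hle : charIdeal R (R ⧸ Ideal.span {π₀ ^ m * g}) ≤ charIdeal R (R ⧸ Ideal.span {L}) := by
      rw [hcharQ, hcharL, Ideal.span_singleton_le_span_singleton]
      exact ⟨h, hmh⟩
    rw [← hleng 𝔭 h𝔭, ← lengthAt_quotient_span_pow_mul_eq_of_not_mem hπ₀ m g 𝔭 hπ𝔭]
    exact SkinnerUrban2014.lengthAt_le_of_charIdeal_le hQ hQL hle 𝔭 h𝔭
  · intro hloc
    obtain ⟨m, hm⟩ := exists_pow_mul_mem_charIdeal_of_lengthAt_le hQL hπ₀ hg0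
      fun 𝔭 h𝔭 hπ𝔭 ↦ (hloc 𝔭 h𝔭 hπ𝔭).trans (hleng 𝔭 h𝔭).ge
    rw [hcharL] at hm
    obtain ⟨h, hh⟩ := Ideal.mem_span_singleton'.mp hm
    exact ⟨m, h, by rw [← hh, mul_comm]⟩

end Algebra

/-! ## §2 The (LD±2^k)-shaped conclusion versus local lengths off `p` (any `p`, any sign, any dual datum) -/

section AnyPrime

variable {p : ℕ} [Fact p.Prime] {K : Type} [Field K] [NumberField K] {W : WeierstrassCurve K} [W.IsElliptic]
  {κ : ZpExtension K p} {γ : Field.absoluteGaloisGroup K} {ε : ℤˣ}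

/-- A non-zero integer is a unit times a power of `p` in `ℤ_p`. [folklore] -/
private theorem exists_unit_mul_pow_eq_intCast {n : ℤ} (hn : n ≠ 0) :
    ∃ (u : ℤ_[p]ˣ) (b : ℕ), (n : ℤ_[p]) = (u : ℤ_[p]) * (p : ℤ_[p]) ^ b := by
  have hn' : (n : ℤ_[p]) ≠ 0 := Int.cast_ne_zero.mpr hn
  exact ⟨PadicInt.unitCoeff hn', (n : ℤ_[p]).valuation, PadicInt.unitCoeff_spec hn'⟩

/-- `ι(C c · x) = C c · ι x` for `c ∈ ℤ_p` (coefficientwise inclusion `Λ → ℚ_p⟦T⟧`). [folklore] -/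
private theorem iota_C_mul (c : ℤ_[p]) (x : IwasawaAlgebra p) :
    iwasawaToPowerSeries p (PowerSeries.C c * x) =
      PowerSeries.C (c : ℚ_[p]) * iwasawaToPowerSeries p x := by
  rw [map_mul, PowerSeries.map_C]; rfl

/-- `ι(C c ^ m · x) = C (c ^ m) · ι x` for `c ∈ ℤ_p`. [folklore] -/
private theorem iota_C_pow_mul (c : ℤ_[p]) (m : ℕ) (x : IwasawaAlgebra p) :
    iwasawaToPowerSeries p (PowerSeries.C c ^ m * x) =
      PowerSeries.C ((c : ℚ_[p]) ^ m) * iwasawaToPowerSeries p x := by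
  rw [← map_pow, iota_C_mul, PadicInt.coe_pow]

omit [W.IsElliptic] in
/-- **The (LD±2^k)-shape ⟺ `L ∣ p^k·g` in `Λ`** (the period ratio and the two `p`-powers are cosmetic): for a dual datum `D`,
`L ∈ Λ` and `ϖ ∈ ℚˣ`, `(∃ g h m m', char X^ε = (g) ∧ C(p^{m'})·ι g = C(p^m·ϖ)·ι(L·h)) ↔ ∃ g, char X^ε = (g) ∧ ∃ k h, C(p)^k·g = L·h`.
`→`: clear the denominator of `ϖ = n/d` (`d = u'·p^c` in `ℤ_p`) and use the injectivity of `ι`; `←`: `n = u·p^b`, so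
`C(p^{k+b})·ι g = C(ϖ)·ι(L·h·C(d·u⁻¹))`. [cite: Kobayashi2003, Thm. 1.3 (i) (p. 2) and Thm. 4.1 (p. 8)] -/
theorem lowerUpTo_iff_exists_C_pow_mul_eq (D : SignedSelmerDualData W κ γ ε) (L : IwasawaAlgebra p)
    {ϖ : ℚ} (hϖ : ϖ ≠ 0) :
    (∃ (g h : IwasawaAlgebra p) (m m' : ℕ), D.charIdeal = Ideal.span {g} ∧
      PowerSeries.C ((p : ℚ_[p]) ^ m') * iwasawaToPowerSeries p g =
        PowerSeries.C ((p : ℚ_[p]) ^ m * (ϖ : ℚ_[p])) * iwasawaToPowerSeries p (L * h)) ↔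
    ∃ g : IwasawaAlgebra p, D.charIdeal = Ideal.span {g} ∧
      ∃ (k : ℕ) (h : IwasawaAlgebra p), PowerSeries.C (p : ℤ_[p]) ^ k * g = L * h := by
  -- `ϖ = n / d`; in `ℤ_p`: `n = u · p^b`, `d = u' · p^c`
  set n : ℤ := ϖ.num with hndef
  set d : ℤ := (ϖ.den : ℤ) with hddef
  have hn : n ≠ 0 := Rat.num_ne_zero.mpr hϖ
  have hd : d ≠ 0 := Int.natCast_ne_zero.mpr ϖ.den_nz
  obtain ⟨u, b, hu⟩ := exists_unit_mul_pow_eq_intCast (p := p) hn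
  obtain ⟨u', c, hu'⟩ := exists_unit_mul_pow_eq_intCast (p := p) hd
  have hϖnd : (ϖ : ℚ_[p]) * ((d : ℤ_[p]) : ℚ_[p]) = ((n : ℤ_[p]) : ℚ_[p]) := by
    rw [PadicInt.coe_intCast, PadicInt.coe_intCast, hndef, hddef]
    have h := Rat.mul_den_eq_num ϖ
    exact_mod_cast congrArg (fun q : ℚ ↦ (q : ℚ_[p])) h
  have huu : ((u : ℤ_[p]) : ℚ_[p]) * (((u⁻¹ : ℤ_[p]ˣ) : ℤ_[p]) : ℚ_[p]) = 1 := by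
    rw [← PadicInt.coe_mul, Units.mul_inv, PadicInt.coe_one]
  constructor
  · rintro ⟨g, h, m, m', hg, hgh⟩
    have hd' : ((d : ℤ_[p]) : ℚ_[p]) = ((u' : ℤ_[p]) : ℚ_[p]) * (p : ℚ_[p]) ^ c := by
      rw [hu', PadicInt.coe_mul, PadicInt.coe_pow, PadicInt.coe_natCast]
    -- the integral identity `C u' · C(p)^(m'+c) · g = L · (C(p^m·n) · h)`, by clearing the denominator `d` of `ϖ`
    have hint : PowerSeries.C ((u' : ℤ_[p]ˣ) : ℤ_[p]) * (PowerSeries.C (p : ℤ_[p]) ^ (m' + c) * g) =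
        L * (PowerSeries.C ((p : ℤ_[p]) ^ m * (n : ℤ_[p])) * h) := by
      apply iwasawaToPowerSeries_injective p
      have lhs : iwasawaToPowerSeries p
            (PowerSeries.C ((u' : ℤ_[p]ˣ) : ℤ_[p]) * (PowerSeries.C (p : ℤ_[p]) ^ (m' + c) * g)) =
          PowerSeries.C ((d : ℤ_[p]) : ℚ_[p]) * (PowerSeries.C ((p : ℚ_[p]) ^ m') * iwasawaToPowerSeries p g) := by
        rw [iota_C_mul, iota_C_pow_mul, PadicInt.coe_natCast, ← mul_assoc, ← mul_assoc, ← map_mul, ← map_mul, hd']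
        congr 2
        ring
      have rhs : iwasawaToPowerSeries p (L * (PowerSeries.C ((p : ℤ_[p]) ^ m * (n : ℤ_[p])) * h)) =
          PowerSeries.C ((d : ℤ_[p]) : ℚ_[p]) *
            (PowerSeries.C ((p : ℚ_[p]) ^ m * (ϖ : ℚ_[p])) * iwasawaToPowerSeries p (L * h)) := by
        rw [mul_left_comm, iota_C_mul, PadicInt.coe_mul, PadicInt.coe_pow, PadicInt.coe_natCast, ← mul_assoc,
          ← map_mul]
        congr 2
        linear_combination ((p : ℚ_[p]) ^ m) * hϖnd.symm
      rw [lhs, rhs, hgh]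
    have hC1 : PowerSeries.C (((u'⁻¹ : ℤ_[p]ˣ) : ℤ_[p])) * PowerSeries.C ((u' : ℤ_[p]ˣ) : ℤ_[p]) =
        (1 : IwasawaAlgebra p) := by
      rw [← map_mul, Units.inv_mul, map_one]
    refine ⟨g, hg, m' + c, PowerSeries.C (((u'⁻¹ : ℤ_[p]ˣ) : ℤ_[p]) * ((p : ℤ_[p]) ^ m * (n : ℤ_[p]))) * h, ?_⟩
    calc PowerSeries.C (p : ℤ_[p]) ^ (m' + c) * g
        = PowerSeries.C (((u'⁻¹ : ℤ_[p]ˣ) : ℤ_[p])) * PowerSeries.C ((u' : ℤ_[p]ˣ) : ℤ_[p]) *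
            (PowerSeries.C (p : ℤ_[p]) ^ (m' + c) * g) := by rw [hC1, one_mul]
      _ = PowerSeries.C (((u'⁻¹ : ℤ_[p]ˣ) : ℤ_[p])) * (L * (PowerSeries.C ((p : ℤ_[p]) ^ m * (n : ℤ_[p])) * h)) := by
          rw [mul_assoc, hint]
      _ = L * (PowerSeries.C (((u'⁻¹ : ℤ_[p]ˣ) : ℤ_[p]) * ((p : ℤ_[p]) ^ m * (n : ℤ_[p]))) * h) := by
          simp only [map_mul]
          ring
  · rintro ⟨g, hg, k, h, hkh⟩
    -- `C(p)^k · g = L · h` ⟹ `C(p^(k+b)) · ι g = C(p^0 · ϖ) · ι(L · (h · C(d·u⁻¹)))`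
    refine ⟨g, h * PowerSeries.C ((d : ℤ_[p]) * ((u⁻¹ : ℤ_[p]ˣ) : ℤ_[p])), 0, k + b, hg, ?_⟩
    have key : PowerSeries.C ((p : ℚ_[p]) ^ k) * iwasawaToPowerSeries p g = iwasawaToPowerSeries p (L * h) := by
      rw [← hkh, iota_C_pow_mul, PadicInt.coe_natCast]
    have hn' : ((n : ℤ_[p]) : ℚ_[p]) = ((u : ℤ_[p]) : ℚ_[p]) * (p : ℚ_[p]) ^ b := by
      rw [hu, PadicInt.coe_mul, PadicInt.coe_pow, PadicInt.coe_natCast]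
    have hsc : (p : ℚ_[p]) ^ 0 * (ϖ : ℚ_[p]) * (((d : ℤ_[p]) * ((u⁻¹ : ℤ_[p]ˣ) : ℤ_[p]) : ℤ_[p]) : ℚ_[p]) =
        (p : ℚ_[p]) ^ b := by
      rw [PadicInt.coe_mul, pow_zero, one_mul]
      linear_combination (((u⁻¹ : ℤ_[p]ˣ) : ℤ_[p]) : ℚ_[p]) * hϖnd +
        (((u⁻¹ : ℤ_[p]ˣ) : ℤ_[p]) : ℚ_[p]) * hn' + (p : ℚ_[p]) ^ b * huu
    calc PowerSeries.C ((p : ℚ_[p]) ^ (k + b)) * iwasawaToPowerSeries p g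
        = PowerSeries.C ((p : ℚ_[p]) ^ b) * (PowerSeries.C ((p : ℚ_[p]) ^ k) * iwasawaToPowerSeries p g) := by
          rw [← mul_assoc, ← map_mul, ← pow_add, add_comm]
      _ = PowerSeries.C ((p : ℚ_[p]) ^ b) * iwasawaToPowerSeries p (L * h) := by rw [key]
      _ = PowerSeries.C ((p : ℚ_[p]) ^ 0 * (ϖ : ℚ_[p])) *
            iwasawaToPowerSeries p (L * (h * PowerSeries.C ((d : ℤ_[p]) * ((u⁻¹ : ℤ_[p]ˣ) : ℤ_[p])))) := by
          rw [← mul_assoc L h, mul_comm (L * h) (PowerSeries.C _), iota_C_mul, ← mul_assoc, ← map_mul, hsc]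

/-- **(LD±2^k)-shape ⟹ lower divisibility in local lengths off `p`, UNCONDITIONALLY.** For a dual datum `D` of `Sel^ε(E/K_∞)`
(its `X^ε` is finitely generated over `Λ`: `SignedSelmerDualData.moduleFinite`), `L ≠ 0` and `ϖ ∈ ℚˣ`: if
`∃ g h m m', char X^ε = (g) ∧ C(p^{m'})·ι g = C(p^m·ϖ)·ι(L·h)`, then `ℓ_𝔭(Λ/(L)) ≤ ℓ_𝔭(X^ε)` at every height-one `𝔭 ∌ p`.
On torsion this is §1; off torsion `X^ε` has a torsion-free element and `ℓ_𝔭(X^ε) = ⊤` at every non-zero prime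
(`UniversalToricDescentCharIdealVacuity.lengthAt_eq_top_of_torsionFree`). [cite: Kobayashi2003, Thm. 1.3 (i) (p. 2)]
[cite: Washington1997, §13.2] -/
theorem lengthAt_quotient_le_of_lowerUpTo (hγ : κ.IsTopGenerator γ) (D : SignedSelmerDualData W κ γ ε)
    {L : IwasawaAlgebra p} (hL : L ≠ 0) {ϖ : ℚ} (hϖ : ϖ ≠ 0)
    (hlow : ∃ (g h : IwasawaAlgebra p) (m m' : ℕ), D.charIdeal = Ideal.span {g} ∧
      PowerSeries.C ((p : ℚ_[p]) ^ m') * iwasawaToPowerSeries p g =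
        PowerSeries.C ((p : ℚ_[p]) ^ m * (ϖ : ℚ_[p])) * iwasawaToPowerSeries p (L * h)) :
    ∀ 𝔭 : PrimeSpectrum (IwasawaAlgebra p), 𝔭.asIdeal.height = 1 →
      PowerSeries.C (p : ℤ_[p]) ∉ 𝔭.asIdeal →
      lengthAt (IwasawaAlgebra p) (IwasawaAlgebra p ⧸ Ideal.span {L}) 𝔭 ≤
        lengthAt (IwasawaAlgebra p) D.X 𝔭 := by
  haveI : Module.Finite (IwasawaAlgebra p) D.X := D.moduleFinite hγ
  intro 𝔭 h𝔭 hp𝔭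
  by_cases hX : Module.IsTorsion (IwasawaAlgebra p) D.X
  · obtain ⟨g, hg, k, h, hkh⟩ := (lowerUpTo_iff_exists_C_pow_mul_eq D L hϖ).mp hlow
    exact (exists_pow_mul_eq_mul_iff_lengthAt_quotient_le hX (IwasawaAlgebra.prime_C p) hL hg).mp
      ⟨k, h, hkh⟩ 𝔭 h𝔭 hp𝔭
  · -- off torsion: a torsion-free element makes `ℓ_𝔭(X) = ⊤`
    have hX' : ∃ x : D.X, ∀ r : IwasawaAlgebra p, r • x = 0 → r = 0 := by
      by_contra hcon
      refine hX fun x ↦ ?_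
      by_contra hx
      refine hcon ⟨x, fun r hr ↦ ?_⟩
      by_contra hr0
      exact hx ⟨⟨r, mem_nonZeroDivisors_of_ne_zero hr0⟩, hr⟩
    obtain ⟨x, hx⟩ := hX'
    rw [UniversalToricDescentCharIdealVacuity.lengthAt_eq_top_of_torsionFree hx 𝔭
      (Ideal.ne_bot_of_height_eq_one h𝔭)]
    exact le_top

/-- **Lower divisibility in local lengths off `p` ⟹ the (LD±2^k)-shape, ON TORSION.** For a dual datum `D` with `X^ε`
`Λ`-torsion, `L ≠ 0` and `ϖ ∈ ℚˣ`: if `ℓ_𝔭(Λ/(L)) ≤ ℓ_𝔭(X^ε)` at every height-one `𝔭 ∌ p`, then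
`∃ g h m m', char X^ε = (g) ∧ C(p^{m'})·ι g = C(p^m·ϖ)·ι(L·h)` (`char X^ε` is principal: `charIdeal_isPrincipal_holds`; then §1).
Torsion is a genuine hypothesis here: off torsion `char X^ε = ⊤` (junk) and the shape would force `L ∣ p^k`.
[cite: Kobayashi2003, Thm. 1.3 (i) (p. 2)] [cite: Washington1997, §13.2] -/
theorem lowerUpTo_of_lengthAt_quotient_le (hγ : κ.IsTopGenerator γ) (D : SignedSelmerDualData W κ γ ε)
    (hX : Module.IsTorsion (IwasawaAlgebra p) D.X) {L : IwasawaAlgebra p} (hL : L ≠ 0) {ϖ : ℚ} (hϖ : ϖ ≠ 0)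
    (hloc : ∀ 𝔭 : PrimeSpectrum (IwasawaAlgebra p), 𝔭.asIdeal.height = 1 →
      PowerSeries.C (p : ℤ_[p]) ∉ 𝔭.asIdeal →
      lengthAt (IwasawaAlgebra p) (IwasawaAlgebra p ⧸ Ideal.span {L}) 𝔭 ≤
        lengthAt (IwasawaAlgebra p) D.X 𝔭) :
    ∃ (g h : IwasawaAlgebra p) (m m' : ℕ), D.charIdeal = Ideal.span {g} ∧
      PowerSeries.C ((p : ℚ_[p]) ^ m') * iwasawaToPowerSeries p g =
        PowerSeries.C ((p : ℚ_[p]) ^ m * (ϖ : ℚ_[p])) * iwasawaToPowerSeries p (L * h) := by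
  haveI : Module.Finite (IwasawaAlgebra p) D.X := D.moduleFinite hγ
  obtain ⟨g, hg⟩ := (charIdeal_isPrincipal_holds p D.X).principal
  have hg' : D.charIdeal = Ideal.span {g} := hg
  obtain ⟨k, h, hkh⟩ :=
    (exists_pow_mul_eq_mul_iff_lengthAt_quotient_le hX (IwasawaAlgebra.prime_C p) hL hg').mpr hloc
  exact (lowerUpTo_iff_exists_C_pow_mul_eq D L hϖ).mpr ⟨g, hg', k, h, hkh⟩

/-- **On torsion, the (LD±2^k)-shape ⟺ lower divisibility in local lengths off `p`** (§2 in `↔` form).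
[cite: Kobayashi2003, Thm. 1.3 (i) (p. 2)] [cite: Washington1997, §13.2] -/
theorem lowerUpTo_iff_lengthAt_quotient_le (hγ : κ.IsTopGenerator γ) (D : SignedSelmerDualData W κ γ ε)
    (hX : Module.IsTorsion (IwasawaAlgebra p) D.X) {L : IwasawaAlgebra p} (hL : L ≠ 0) {ϖ : ℚ} (hϖ : ϖ ≠ 0) :
    (∃ (g h : IwasawaAlgebra p) (m m' : ℕ), D.charIdeal = Ideal.span {g} ∧
      PowerSeries.C ((p : ℚ_[p]) ^ m') * iwasawaToPowerSeries p g =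
        PowerSeries.C ((p : ℚ_[p]) ^ m * (ϖ : ℚ_[p])) * iwasawaToPowerSeries p (L * h)) ↔
    ∀ 𝔭 : PrimeSpectrum (IwasawaAlgebra p), 𝔭.asIdeal.height = 1 →
      PowerSeries.C (p : ℤ_[p]) ∉ 𝔭.asIdeal →
      lengthAt (IwasawaAlgebra p) (IwasawaAlgebra p ⧸ Ideal.span {L}) 𝔭 ≤
        lengthAt (IwasawaAlgebra p) D.X 𝔭 :=
  ⟨lengthAt_quotient_le_of_lowerUpTo hγ D hL hϖ, lowerUpTo_of_lengthAt_quotient_le hγ D hX hL hϖ⟩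

end AnyPrime

end SignedLowerOffTwo

end Summit.BirchSwinnertonDyer.BirchSwinnertonDyer.Theorems

end
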